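/-
Copyright: the b2b-balaban T⁴-continuum CRUX team, row NE7b leaf lineage `t4-ne7b-formalise-leaf-06` (gen 149). Project licence.
-/
import Mathlib.Analysis.Calculus.Gradient.Basic
import Mathlib.Analysis.Calculus.Deriv.MeanValue
import Mathlib.Analysis.Calculus.Deriv.Pow
import Mathlib.Analysis.Calculus.ContDiff.Basic
import Mathlib.Analysis.Calculus.LocalExtr.Basic
import Mathlib.Analysis.Convex.Strong
import Mathlib.Analysis.InnerProductSpace.Calculus

/-!
# THE WAY BACK TO HESSIAN CURRENCY: the road's letter WITH A FORM `Q` — first-order `V x + DV(x)(y − x) + Q(y − x) ≤ V y`, secant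
# `V(a p + b q) + a b Q(q − p) ≤ a V p + b V q`, `ConvexOn (V − W)`, `StrongConvexOn` — at a point where `V` is twice differentiable
# gives the HESSIAN DISPLAY `2·Q(v) ≤ D²V(x)[v, v]`: the CONVERSE of `…HessianFormFirstOrder` (row NE7b, node U5c; residual (R2′)
# family (2), letter (ℓ1) in FORM currency; kernel lemmas of one-variable calculus)

Cell `pub-balaban`, sub-cell `t4`, spine estimate NE7b (`T4WeightBudget.RelWeightBound`; the cell's OWN estimate — NOT PRINTED in
[Bałaban 1983–89], NOT PROVED).  Crux-route work under `Spine/NE7b/` by a row leaf on the convexity road; NOTHING of Bałaban's is named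
or asserted; no `T4Continuum/Support` leaf typed; no `def`; zero `sorry`.  Imports: Mathlib only — independent of the farm's olean frontier.

WHY.  The modulus letter (ℓ1) travels in three currencies — HESSIAN (`2·Q(v) ≤ D²V(x)[v, v]` ON a window: what an instance DISPLAYS;
leaf-03's `…HessianFormFirstOrder` (HFFO) is the entry), FIRST-ORDER ∕ SECANT with a 2-homogeneous form `Q` (`…ConvexityModulusTransport`
§3–§4, `…ConvexityModulusSchur`, `…StrongConvexSubgradientField` §5), and `StrongConvexOn` — and the fluctuation integral
`V ↦ V⁺ = −log ∫_{K_x} e^{−V(x,·)}` RETURNS it in SECANT currency with the inherited base form (`…LogConcaveMarginal` §6).  To display the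
next scale's exponent again in the entry's currency (what the refuter prices as owed «at every scale», PRICING-NE7b v100 §3¹⁰⁰ (i)–(ii):
«(Δ2) scale-to-scale consistency of the base forms — OPEN IN KIND») one needs the way BACK: letter with `Q` ⟹ `2·Q(v) ≤ D²V⁺(x)[v, v]`
wherever `V⁺` is twice differentiable.  The tree has the SCALAR case on `Fin n → ℝ` for global `C²` (`…Balaban1983to89.T4CubeChartExpHessian`,
`…T4CubePoincare.hessianBound_of_firstOrder`); THIS FILE types the FORM case on any real normed space, POINTWISE (`DV` near `x`, `D(DV)` AT
`x`), from each letter shape of the road, with `C²` corollaries in EXACTLY HFFO's hypothesis shape `∀ x ∈ K, ∀ v, 2 * Q v ≤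
iteratedFDeriv ℝ 2 V x ![v, v]`: on an OPEN convex window the Hessian display and the letter with `Q` are EQUIVALENT for `C²` exponents.

WHAT IS PROVED ([folklore] calculus; engine: «`ψ ≥ 0` to the right of a second-order zero forces `ψ″(0) ≥ 0`»):
* §1 (`ℝ → ℝ`) **`deriv2_nonneg_of_eventually_nonneg`** — `ψ 0 = 0`, `ψ′ 0 = 0`, `HasDerivAt ψ (ψ′ t) t` near `0`, `HasDerivAt ψ′ c 0`,
  `0 ≤ ψ t` for small `t > 0` ⟹ `0 ≤ c`; `deriv2_nonneg_of_midpoint` — `2ψ(0) ≤ ψ(t) + ψ(−t)` near `0` ⟹ `0 ≤ c`.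
* §2 pointwise chain rules for the slice `t ↦ V(x + t•v)` from `HasFDerivAt` data AT the points only.
* §3 (pointwise; `hV1 : ∀ᶠ z in 𝓝 x, HasFDerivAt V (fderiv ℝ V z) z`, `hV2 : HasFDerivAt (fderiv ℝ V) V″ x`): **`le_hessian_of_firstOrder_ray`**
  (the letter AT `x` along ONE ray, `V x + DV(x)(t•v) + t²q ≤ V(x + t•v)` for small `t > 0` ⟹ `2q ≤ V″ v v`),
  **`le_hessian_of_firstOrderForm_nhds`** (the letter at `x` with any covector `p` and a 2-homogeneous `Q` on `K ∈ 𝓝 x` ⟹ `2·Q(v) ≤ V″ v v`;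
  Fermat forces `p v = DV(x) v` on each line), **`le_hessian_of_secantForm_nhds`** (the SECANT letter with `Q` on `K ∈ 𝓝 x` — verbatim
  `…LogConcaveMarginal` §6's output shape — midpoints `x ± t•v`), **`hessian_mono_of_convexOn_sub_nhds`** (`ConvexOn ℝ K (V − W)` ⟹
  `W″ v v ≤ V″ v v`), `le_hessian_of_strongConvexOn_nhds` (`m‖v‖² ≤ V″ v v`).
* §4 (`C²` NEAR the point ∕ ON `interior K` only — `ContDiffAt ℝ 2 V x` ∕ `ContDiffOn ℝ 2 V (interior K)`, what a windowed marginal supplies;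
  chair leaf-05 g149's offer ο-leaf05-g149-2, adopted; a global `ContDiff` feeds it by `.contDiffAt` ∕ `.contDiffOn`):
  `hessian_lower_of_firstOrderOn_form_inward` (any `x ∈ K`, directions with `x + t•v ∈ K` for small `t > 0` — boundary points),
  **`hessianOn_lower_of_firstOrderOn_form_fderiv`** (interior points; open `K`: VERBATIM HFFO §1's `hH` — the round trip),
  **`hessianOn_lower_of_secantForm`**, `hessianOn_mono_of_convexOn_sub`, `hessianOn_lower_of_strongConvexOn` (`m‖v‖² ≤ D²V(x)[v, v]` —
  `…ConvexWindowSuppliers.firstOrderOn_of_hessianOn_lower`'s `hH`, `κ := m`), gradient-currency `hessianOn_lower_of_firstOrderOn_form`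
  (HFFO §2's letter) and field-currency `hessianOn_lower_of_firstOrderOn_formField` (`…ConvexityModulusTransport` §3's `h`; `dV = ∇V` forced).
* §5 a kernel toy (`V = Q = ‖·‖²`: the letter is an equality and the converse returns the sharp `2‖v‖² ≤ D²V(x)[v, v]`).

NOT HERE (honest): that a windowed MARGINAL is `C²` (product windows: the sibling supplier `…FibreWindowHessian`; joint windows: false in
general); which exponents of print display which block form in which chart ((A3) ∕ (A1c), NC-NE7b-α UNRULED); anything of Bałaban's.
BY-NAME EFFECT ON THE WALL: NONE.  NE7b NOT PRINTED ∕ NOT PROVED; spine PROVED 0∕9; rung (B)+1 on a FINITE torus — NOT infinite volume,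
NOT the mass gap, NOT Clay.  HONEST DEPENDENCY: continuum YM on T⁴ ⇐ BetaPertH ∧ nine spine estimates (0/9 proved); BetaPertH ⇐ (D1) ∧
(D4) ∧ CAP+tail.
-/

set_option autoImplicit false

open Set Filter Topology
open scoped RealInnerProductSpace

namespace Summit.QuantumFields.BalabanUV.T4Continuum.NE7b.HessianFloorOfFormLetter

/-! ## §1 The one-variable engine -/

/-- **SIGN OF A SECOND-ORDER ZERO**: `ψ(0) = 0`, `ψ′(0) = 0`, `ψ` differentiable near `0` with derivative `ψ′`, `ψ′` differentiable at
`0` with derivative `c`, and `ψ(t) ≥ 0` for all small `t > 0` ⟹ `c ≥ 0` (if `c < 0` then `ψ′ < 0` on some `(0, δ)` and, by the mean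
value theorem, `ψ(t) < ψ(0) = 0` there). [folklore] -/
theorem deriv2_nonneg_of_eventually_nonneg {ψ ψ' : ℝ → ℝ} {c : ℝ} (h0 : ψ 0 = 0) (h0' : ψ' 0 = 0)
    (hd : ∀ᶠ t in 𝓝 (0 : ℝ), HasDerivAt ψ (ψ' t) t) (hd2 : HasDerivAt ψ' c 0)
    (hpos : ∀ᶠ t in 𝓝[>] (0 : ℝ), 0 ≤ ψ t) : 0 ≤ c := by
  by_contra hc
  have hc : c < 0 := lt_of_not_ge hc
  have hneg : ∀ᶠ t in 𝓝[>] (0 : ℝ), ψ' t < 0 := by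
    have h1 : ∀ᶠ t in 𝓝[>] (0 : ℝ), t⁻¹ • (ψ' (0 + t) - ψ' 0) < c / 2 :=
      hd2.tendsto_slope_zero_right.eventually_lt_const (by linarith)
    have h2 : ∀ᶠ t in 𝓝[>] (0 : ℝ), 0 < t := eventually_mem_nhdsWithin
    filter_upwards [h1, h2] with t ht htpos
    rw [zero_add, h0', sub_zero, smul_eq_mul, inv_mul_eq_div, div_lt_iff₀ htpos] at ht
    nlinarith
  obtain ⟨ε₁, hε₁, hball⟩ := Metric.eventually_nhds_iff.1 hd
  obtain ⟨u, hu, hIoo⟩ := mem_nhdsGT_iff_exists_Ioo_subset.1 (hneg.and hpos)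
  set t₀ : ℝ := min u ε₁ / 2 with ht₀
  have ht₀pos : 0 < t₀ := by rw [ht₀]; exact half_pos (lt_min hu hε₁)
  have ht₀u : t₀ < u := by rw [ht₀]; linarith [min_le_left u ε₁]
  have hderiv : ∀ t ∈ Icc (0 : ℝ) t₀, HasDerivAt ψ (ψ' t) t := fun t ht => hball (by
    rw [Real.dist_eq, sub_zero, abs_of_nonneg ht.1]; linarith [min_le_right u ε₁, ht.2])
  obtain ⟨ξ, hξ, hξeq⟩ := exists_hasDerivAt_eq_slope ψ ψ' ht₀pos
    (fun t ht => (hderiv t ht).continuousAt.continuousWithinAt) (fun t ht => hderiv t ⟨ht.1.le, ht.2.le⟩)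
  have hξneg : ψ' ξ < 0 := (hIoo ⟨hξ.1, lt_trans hξ.2 ht₀u⟩).1
  rw [h0, sub_zero, sub_zero, eq_div_iff ht₀pos.ne'] at hξeq
  nlinarith [(hIoo ⟨ht₀pos, ht₀u⟩).2]

/-- **MIDPOINT VERSION**: `ψ` differentiable near `0` with derivative `ψ′`, `ψ′` differentiable at `0` with derivative `c`, and
`2ψ(0) ≤ ψ(t) + ψ(−t)` for all small `t` ⟹ `0 ≤ c` (the sign lemma for the even function `ψ(t) + ψ(−t) − 2ψ(0)`). [folklore] -/
theorem deriv2_nonneg_of_midpoint {ψ ψ' : ℝ → ℝ} {c : ℝ}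
    (hd : ∀ᶠ t in 𝓝 (0 : ℝ), HasDerivAt ψ (ψ' t) t) (hd2 : HasDerivAt ψ' c 0)
    (hmid : ∀ᶠ t in 𝓝 (0 : ℝ), 2 * ψ 0 ≤ ψ t + ψ (-t)) : 0 ≤ c := by
  set χ : ℝ → ℝ := fun t => ψ t + ψ (-t) - 2 * ψ 0 with hχ
  set χ' : ℝ → ℝ := fun t => ψ' t - ψ' (-t) with hχ'
  have hflip : Tendsto (fun t : ℝ => -t) (𝓝 0) (𝓝 0) := by simpa using (continuous_neg.tendsto (0 : ℝ))
  have hχd : ∀ᶠ t in 𝓝 (0 : ℝ), HasDerivAt χ (χ' t) t := by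
    filter_upwards [hd, hflip.eventually hd] with t h1 h2
    have h2' : HasDerivAt (fun s : ℝ => ψ (-s)) (-ψ' (-t)) t := (h2.comp t (hasDerivAt_neg t)).congr_deriv (by ring)
    exact ((h1.add h2').sub_const (2 * ψ 0)).congr_deriv (by simp only [hχ']; ring)
  have hχd2 : HasDerivAt χ' (2 * c) 0 := by
    have hn : HasDerivAt ψ' c (-0) := by rw [neg_zero]; exact hd2
    have h2 : HasDerivAt (fun s : ℝ => ψ' (-s)) (-c) 0 := (hn.comp (0 : ℝ) (hasDerivAt_neg (0 : ℝ))).congr_deriv (by ring)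
    exact (hd2.sub h2).congr_deriv (by ring)
  have hpos : ∀ᶠ t in 𝓝[>] (0 : ℝ), 0 ≤ χ t :=
    nhdsWithin_le_nhds (hmid.mono fun t ht => by simp only [hχ]; linarith)
  have := deriv2_nonneg_of_eventually_nonneg (by simp [hχ]; ring) (by simp [hχ']) hχd hχd2 hpos
  linarith

/-! ## §2 The slice of `V` along a line: pointwise chain rules -/

section Line

variable {E : Type*} [NormedAddCommGroup E] [NormedSpace ℝ E]

/-- The slice `t ↦ V(x + t•v)` has derivative `DV(x + t•v) v` at `t` whenever `V` is differentiable at `x + t•v`. [folklore] -/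
theorem hasDerivAt_lineSlice {V : E → ℝ} {x v : E} {t : ℝ} {V' : E →L[ℝ] ℝ} (h : HasFDerivAt V V' (x + t • v)) :
    HasDerivAt (fun s : ℝ => V (x + s • v)) (V' v) t := by
  have hl : HasDerivAt (fun s : ℝ => x + s • v) v t := by simpa using ((hasDerivAt_id t).smul_const v).const_add x
  exact h.comp_hasDerivAt t hl

/-- The slice of the derivative `t ↦ DV(x + t•v) v` has derivative `V″ v v` at `t = 0` if `DV` has derivative `V″` at `x`. [folklore] -/
theorem hasDerivAt_fderiv_lineSlice_apply {V : E → ℝ} {x v : E} {V'' : E →L[ℝ] E →L[ℝ] ℝ}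
    (h : HasFDerivAt (fderiv ℝ V) V'' x) : HasDerivAt (fun s : ℝ => fderiv ℝ V (x + s • v) v) (V'' v v) 0 := by
  have hl : HasDerivAt (fun s : ℝ => x + s • v) v 0 := by simpa using ((hasDerivAt_id (0 : ℝ)).smul_const v).const_add x
  have h' : HasFDerivAt (fderiv ℝ V) V'' (x + (0 : ℝ) • v) := by rw [zero_smul, add_zero]; exact h
  have hc : HasDerivAt (fun s : ℝ => fderiv ℝ V (x + s • v)) (V'' v) 0 := h'.comp_hasDerivAt (0 : ℝ) hl
  exact (hc.clm_apply (hasDerivAt_const (0 : ℝ) v)).congr_deriv (by simp)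

/-- Near `t = 0` the slice is differentiable with derivative `DV(x + t•v) v`, if `V` is differentiable near `x`. [folklore] -/
theorem eventually_hasDerivAt_lineSlice {V : E → ℝ} {x : E} (v : E) (hV1 : ∀ᶠ z in 𝓝 x, HasFDerivAt V (fderiv ℝ V z) z) :
    ∀ᶠ t in 𝓝 (0 : ℝ), HasDerivAt (fun s : ℝ => V (x + s • v)) (fderiv ℝ V (x + t • v) v) t :=
  (((show Continuous fun t : ℝ => x + t • v by fun_prop).tendsto' 0 x (by simp)).eventually hV1).mono
    fun _ ht => hasDerivAt_lineSlice ht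

/-- Points of the line near `t = 0` lie in any neighbourhood of `x`. [folklore] -/
theorem eventually_lineSlice_mem {x : E} (v : E) {K : Set E} (hK : K ∈ 𝓝 x) : ∀ᶠ t in 𝓝 (0 : ℝ), x + t • v ∈ K :=
  ((show Continuous fun t : ℝ => x + t • v by fun_prop).tendsto' 0 x (by simp)).eventually (eventually_mem_set.2 hK)

/-! ## §3 The pointwise converses: letter with a form at a point of twice-differentiability ⟹ Hessian display -/

/-- **ONE RAY SUFFICES** (boundary points, inward directions): `V` differentiable near `x`, `DV` differentiable at `x` (derivative
`V″`), and the first-order letter AT `x` along the ray, `V x + DV(x)(t•v) + t²q ≤ V(x + t•v)` for small `t > 0` ⟹ `2q ≤ V″ v v`. [folklore] -/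
theorem le_hessian_of_firstOrder_ray {V : E → ℝ} {x v : E} {V'' : E →L[ℝ] E →L[ℝ] ℝ} {q : ℝ}
    (hV1 : ∀ᶠ z in 𝓝 x, HasFDerivAt V (fderiv ℝ V z) z) (hV2 : HasFDerivAt (fderiv ℝ V) V'' x)
    (h : ∀ᶠ t in 𝓝[>] (0 : ℝ), V x + fderiv ℝ V x (t • v) + t ^ 2 * q ≤ V (x + t • v)) : 2 * q ≤ V'' v v := by
  set ψ : ℝ → ℝ := fun t => V (x + t • v) - V x - t * fderiv ℝ V x v - t ^ 2 * q with hψ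
  set ψ' : ℝ → ℝ := fun t => fderiv ℝ V (x + t • v) v - fderiv ℝ V x v - 2 * t * q with hψ'
  have hd : ∀ᶠ t in 𝓝 (0 : ℝ), HasDerivAt ψ (ψ' t) t := by
    filter_upwards [eventually_hasDerivAt_lineSlice v hV1] with t ht
    have h2 : HasDerivAt (fun s : ℝ => s * fderiv ℝ V x v) (fderiv ℝ V x v) t := by simpa using (hasDerivAt_id t).mul_const _
    have h3 : HasDerivAt (fun s : ℝ => s ^ 2 * q) (2 * t * q) t := by simpa using (hasDerivAt_pow 2 t).mul_const q
    exact (((ht.sub_const (V x)).sub h2).sub h3).congr_deriv (by simp [hψ'])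
  have hd2 : HasDerivAt ψ' (V'' v v - 2 * q) 0 := by
    have h3 : HasDerivAt (fun s : ℝ => 2 * s * q) (2 * q) 0 := by simpa using ((hasDerivAt_id (0 : ℝ)).const_mul (2 : ℝ)).mul_const q
    exact ((hasDerivAt_fderiv_lineSlice_apply hV2).sub_const (fderiv ℝ V x v)).sub h3
  have hpos : ∀ᶠ t in 𝓝[>] (0 : ℝ), 0 ≤ ψ t := by
    filter_upwards [h] with t ht
    rw [map_smul, smul_eq_mul] at ht
    simp only [hψ]; linarith
  have := deriv2_nonneg_of_eventually_nonneg (by simp [hψ]) (by simp [hψ']) hd hd2 hpos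
  linarith

/-- **FIRST-ORDER LETTER WITH A FORM ON A NEIGHBOURHOOD ⟹ HESSIAN DISPLAY** (pointwise): on some `K ∈ 𝓝 x` the letter AT `x` holds
with a covector `p` (a field value `dV x`, through `⟪·,·⟫` or not) and a 2-homogeneous `Q`, `V x + p(y − x) + Q(y − x) ≤ V y` for `y ∈ K`,
and `V` is differentiable near `x` with `DV` differentiable at `x` (derivative `V″`) ⟹ `2·Q(v) ≤ V″ v v` for every `v` (`p` need not be
`DV x`: on each line Fermat's lemma forces `p v = DV(x) v`). [folklore] -/
theorem le_hessian_of_firstOrderForm_nhds {V : E → ℝ} {x : E} {V'' : E →L[ℝ] E →L[ℝ] ℝ} {K : Set E} (hK : K ∈ 𝓝 x)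
    (hV1 : ∀ᶠ z in 𝓝 x, HasFDerivAt V (fderiv ℝ V z) z) (hV2 : HasFDerivAt (fderiv ℝ V) V'' x)
    (Q : E → ℝ) (hQ : ∀ (t : ℝ) (v : E), Q (t • v) = t ^ 2 * Q v) (p : E →L[ℝ] ℝ)
    (h : ∀ y ∈ K, V x + p (y - x) + Q (y - x) ≤ V y) (v : E) : 2 * Q v ≤ V'' v v := by
  have hφmin : IsLocalMin (fun t : ℝ => V (x + t • v) - V x - t * p v - t ^ 2 * Q v) 0 := by
    refine (eventually_lineSlice_mem v hK).mono fun t ht => ?_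
    have := h _ ht
    rw [add_sub_cancel_left, map_smul, smul_eq_mul, hQ] at this
    simp only [zero_smul, add_zero, sub_self, zero_mul, zero_pow two_ne_zero]
    linarith
  have hφd : HasDerivAt (fun t : ℝ => V (x + t • v) - V x - t * p v - t ^ 2 * Q v) (fderiv ℝ V x v - p v) 0 := by
    have hx : HasFDerivAt V (fderiv ℝ V x) (x + (0 : ℝ) • v) := by simpa using hV1.self_of_nhds
    have h2 : HasDerivAt (fun s : ℝ => s * p v) (p v) 0 := by simpa using (hasDerivAt_id (0 : ℝ)).mul_const (p v)
    have h3 : HasDerivAt (fun s : ℝ => s ^ 2 * Q v) 0 0 := by simpa using (hasDerivAt_pow 2 (0 : ℝ)).mul_const (Q v)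
    exact ((((hasDerivAt_lineSlice hx).sub_const (V x)).sub h2).sub h3).congr_deriv (by ring)
  have hpv : p v = fderiv ℝ V x v := by linarith [hφmin.hasDerivAt_eq_zero hφd]
  refine le_hessian_of_firstOrder_ray hV1 hV2 (nhdsWithin_le_nhds ?_)
  filter_upwards [eventually_lineSlice_mem v hK] with t ht
  have := h _ ht
  rw [add_sub_cancel_left, map_smul, smul_eq_mul, hQ, hpv] at this
  rw [map_smul, smul_eq_mul]
  linarith

/-- **SECANT LETTER WITH A FORM ON A NEIGHBOURHOOD ⟹ HESSIAN DISPLAY** (pointwise; the output shape of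
`…LogConcaveMarginal.neg_log_fibreIntegral_secant_of_baseForm` ∕ `…ConvexityModulusSchur` §6): on some `K ∈ 𝓝 x`,
`V(a p + b q) + a b Q(q − p) ≤ a V p + b V q` for `p, q ∈ K`, `a, b ≥ 0`, `a + b = 1`, with `Q` 2-homogeneous, and `V` differentiable
near `x` with `DV` differentiable at `x` (derivative `V″`) ⟹ `2·Q(v) ≤ V″ v v` for every `v` (midpoints of `x ± t•v`). [folklore] -/
theorem le_hessian_of_secantForm_nhds {V : E → ℝ} {x : E} {V'' : E →L[ℝ] E →L[ℝ] ℝ} {K : Set E} (hK : K ∈ 𝓝 x)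
    (hV1 : ∀ᶠ z in 𝓝 x, HasFDerivAt V (fderiv ℝ V z) z) (hV2 : HasFDerivAt (fderiv ℝ V) V'' x)
    (Q : E → ℝ) (hQ : ∀ (t : ℝ) (v : E), Q (t • v) = t ^ 2 * Q v)
    (h : ∀ p ∈ K, ∀ q ∈ K, ∀ a b : ℝ, 0 ≤ a → 0 ≤ b → a + b = 1 → V (a • p + b • q) + a * b * Q (q - p) ≤ a * V p + b * V q)
    (v : E) : 2 * Q v ≤ V'' v v := by
  set ψ : ℝ → ℝ := fun t => V (x + t • v) - t ^ 2 * Q v with hψ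
  set ψ' : ℝ → ℝ := fun t => fderiv ℝ V (x + t • v) v - 2 * t * Q v with hψ'
  have hd : ∀ᶠ t in 𝓝 (0 : ℝ), HasDerivAt ψ (ψ' t) t := by
    filter_upwards [eventually_hasDerivAt_lineSlice v hV1] with t ht
    have h3 : HasDerivAt (fun s : ℝ => s ^ 2 * Q v) (2 * t * Q v) t := by simpa using (hasDerivAt_pow 2 t).mul_const (Q v)
    exact (ht.sub h3).congr_deriv (by simp [hψ'])
  have hd2 : HasDerivAt ψ' (V'' v v - 2 * Q v) 0 := (hasDerivAt_fderiv_lineSlice_apply hV2).sub (by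
    simpa using ((hasDerivAt_id (0 : ℝ)).const_mul (2 : ℝ)).mul_const (Q v))
  have hflip : Tendsto (fun t : ℝ => -t) (𝓝 0) (𝓝 0) := by simpa using (continuous_neg.tendsto (0 : ℝ))
  have hmid : ∀ᶠ t in 𝓝 (0 : ℝ), 2 * ψ 0 ≤ ψ t + ψ (-t) := by
    filter_upwards [eventually_lineSlice_mem v hK, hflip.eventually (eventually_lineSlice_mem v hK)] with t ht ht'
    have key := h (x + (-t) • v) ht' (x + t • v) ht (1 / 2) (1 / 2) (by norm_num) (by norm_num) (by norm_num)
    have hmidpt : (1 / 2 : ℝ) • (x + (-t) • v) + (1 / 2 : ℝ) • (x + t • v) = x := by module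
    have hdiff : x + t • v - (x + (-t) • v) = (2 * t) • v := by module
    rw [hmidpt, hdiff, hQ] at key
    simp only [hψ, zero_smul, add_zero]
    nlinarith [key]
  have := deriv2_nonneg_of_midpoint hd hd2 hmid
  linarith

/-- **THE HESSIAN IS MONOTONE IN THE CONVEX ORDER** (pointwise): `V − W` convex on some `K ∈ 𝓝 x`, `V` and `W` differentiable near
`x` with `DV`, `DW` differentiable at `x` (derivatives `V″`, `W″`) ⟹ `W″ v v ≤ V″ v v` for every `v`. [folklore] -/
theorem hessian_mono_of_convexOn_sub_nhds {V W : E → ℝ} {x : E} {V'' W'' : E →L[ℝ] E →L[ℝ] ℝ} {K : Set E} (hK : K ∈ 𝓝 x)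
    (hV1 : ∀ᶠ z in 𝓝 x, HasFDerivAt V (fderiv ℝ V z) z) (hV2 : HasFDerivAt (fderiv ℝ V) V'' x)
    (hW1 : ∀ᶠ z in 𝓝 x, HasFDerivAt W (fderiv ℝ W z) z) (hW2 : HasFDerivAt (fderiv ℝ W) W'' x)
    (h : ConvexOn ℝ K (fun y => V y - W y)) (v : E) : W'' v v ≤ V'' v v := by
  set ψ : ℝ → ℝ := fun t => V (x + t • v) - W (x + t • v) with hψ
  have hd : ∀ᶠ t in 𝓝 (0 : ℝ), HasDerivAt ψ (fderiv ℝ V (x + t • v) v - fderiv ℝ W (x + t • v) v) t := by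
    filter_upwards [eventually_hasDerivAt_lineSlice v hV1, eventually_hasDerivAt_lineSlice v hW1] with t h1 h2
    exact h1.sub h2
  have hd2 : HasDerivAt (fun t : ℝ => fderiv ℝ V (x + t • v) v - fderiv ℝ W (x + t • v) v) (V'' v v - W'' v v) 0 :=
    (hasDerivAt_fderiv_lineSlice_apply hV2).sub (hasDerivAt_fderiv_lineSlice_apply hW2)
  have hflip : Tendsto (fun t : ℝ => -t) (𝓝 0) (𝓝 0) := by simpa using (continuous_neg.tendsto (0 : ℝ))
  have hmid : ∀ᶠ t in 𝓝 (0 : ℝ), 2 * ψ 0 ≤ ψ t + ψ (-t) := by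
    filter_upwards [eventually_lineSlice_mem v hK, hflip.eventually (eventually_lineSlice_mem v hK)] with t ht ht'
    have key := h.2 ht' ht (show (0 : ℝ) ≤ 1 / 2 by norm_num) (show (0 : ℝ) ≤ 1 / 2 by norm_num) (by norm_num)
    have hmidpt : (1 / 2 : ℝ) • (x + (-t) • v) + (1 / 2 : ℝ) • (x + t • v) = x := by module
    rw [hmidpt] at key
    simp only [hψ, zero_smul, add_zero, smul_eq_mul] at key ⊢
    linarith
  linarith [deriv2_nonneg_of_midpoint hd hd2 hmid]

/-- **STRONG CONVEXITY ⟹ HESSIAN FLOOR** (pointwise, scalar modulus): `StrongConvexOn K m V` on some `K ∈ 𝓝 x`, `V` differentiable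
near `x` with `DV` differentiable at `x` (derivative `V″`) ⟹ `m‖v‖² ≤ V″ v v` for every `v`. [folklore] -/
theorem le_hessian_of_strongConvexOn_nhds {V : E → ℝ} {x : E} {V'' : E →L[ℝ] E →L[ℝ] ℝ} {K : Set E} {m : ℝ} (hK : K ∈ 𝓝 x)
    (hV1 : ∀ᶠ z in 𝓝 x, HasFDerivAt V (fderiv ℝ V z) z) (hV2 : HasFDerivAt (fderiv ℝ V) V'' x)
    (h : StrongConvexOn K m V) (v : E) : m * ‖v‖ ^ 2 ≤ V'' v v := by
  have hQ : ∀ (t : ℝ) (w : E), (fun w : E => m / 2 * ‖w‖ ^ 2) (t • w) = t ^ 2 * (fun w : E => m / 2 * ‖w‖ ^ 2) w :=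
    fun t w => by simp only [norm_smul, Real.norm_eq_abs, mul_pow, sq_abs]; ring
  have key : 2 * (m / 2 * ‖v‖ ^ 2) ≤ V'' v v := by
    refine le_hessian_of_secantForm_nhds hK hV1 hV2 (fun w : E => m / 2 * ‖w‖ ^ 2) hQ ?_ v
    intro p hp q hq a b ha hb hab
    have := h.2 hp hq ha hb hab
    rw [smul_eq_mul, smul_eq_mul, norm_sub_rev] at this
    linarith
  linarith

end Line

/-! ## §4 `C²` NEAR the point ∕ ON the open interior of a window: the converses in `…HessianFormFirstOrder`'s currency
`iteratedFDeriv ℝ 2 V x ![v, v]` (regularity asked only where it is used: `ContDiffAt ℝ 2 V x`, resp. `ContDiffOn ℝ 2 V (interior K)` — what a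
windowed marginal supplies; a global `ContDiff ℝ 2 V` feeds them by `hV.contDiffAt` ∕ `hV.contDiffOn`; the `ContDiffOn` currency is chair
leaf-05 g149's offer ο-leaf05-g149-2, adopted) -/

section Window

variable {E : Type*} [NormedAddCommGroup E] [NormedSpace ℝ E]

/-- `V ∈ C²` at `x` ⟹ `V` is differentiable near `x`, with derivative `fderiv ℝ V`. [folklore] -/
theorem eventually_hasFDerivAt_of_contDiffAt {V : E → ℝ} {x : E} (hV : ContDiffAt ℝ 2 V x) :
    ∀ᶠ z in 𝓝 x, HasFDerivAt V (fderiv ℝ V z) z :=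
  (hV.eventually (by simp)).mono fun _ hz => (hz.differentiableAt (by simp)).hasFDerivAt

/-- `V ∈ C²` at `x` ⟹ `fderiv ℝ V` is differentiable at `x`, with derivative `fderiv ℝ (fderiv ℝ V) x`. [folklore] -/
theorem hasFDerivAt_fderiv_of_contDiffAt {V : E → ℝ} {x : E} (hV : ContDiffAt ℝ 2 V x) :
    HasFDerivAt (fderiv ℝ V) (fderiv ℝ (fderiv ℝ V) x) x :=
  ((hV.fderiv_right (m := 1) le_rfl).differentiableAt one_ne_zero).hasFDerivAt

/-- **INWARD DIRECTIONS AT ANY WINDOW POINT** (`fderiv` currency): the first-order letter with a 2-homogeneous `Q` on `K`, `V ∈ C²` at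
`x ∈ K`, and a direction `v` with `x + t•v ∈ K` for all small `t > 0` ⟹ `2·Q(v) ≤ D²V(x)[v, v]`. [folklore] -/
theorem hessian_lower_of_firstOrderOn_form_inward {V : E → ℝ} {K : Set E} (Q : E → ℝ)
    (hQ : ∀ (t : ℝ) (v : E), Q (t • v) = t ^ 2 * Q v) (h : ∀ x ∈ K, ∀ y ∈ K, V x + fderiv ℝ V x (y - x) + Q (y - x) ≤ V y)
    {x : E} (hx : x ∈ K) (hV : ContDiffAt ℝ 2 V x) {v : E} (hv : ∀ᶠ t in 𝓝[>] (0 : ℝ), x + t • v ∈ K) :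
    2 * Q v ≤ iteratedFDeriv ℝ 2 V x ![v, v] := by
  rw [iteratedFDeriv_two_apply]
  exact le_hessian_of_firstOrder_ray (eventually_hasFDerivAt_of_contDiffAt hV) (hasFDerivAt_fderiv_of_contDiffAt hV)
    (hv.mono fun t ht => by have := h x hx _ ht; rwa [add_sub_cancel_left, hQ] at this)

/-- **THE CONVERSE OF `…HessianFormFirstOrder` §1 AT INTERIOR POINTS** (`fderiv` currency): the first-order letter with a
2-homogeneous `Q` on `K` and `V ∈ C²` ON `interior K` ⟹ `2·Q(v) ≤ D²V(x)[v, v]` for every `x ∈ interior K` and every `v` — for `K` OPEN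
(`interior K = K`, `hV.contDiffOn`) VERBATIM the hypothesis `hH` of HFFO's `firstOrderOn_form_of_hessianOn_lower_fderiv`: the round trip.
[folklore] -/
theorem hessianOn_lower_of_firstOrderOn_form_fderiv {V : E → ℝ} {K : Set E} (hV : ContDiffOn ℝ 2 V (interior K)) (Q : E → ℝ)
    (hQ : ∀ (t : ℝ) (v : E), Q (t • v) = t ^ 2 * Q v) (h : ∀ x ∈ K, ∀ y ∈ K, V x + fderiv ℝ V x (y - x) + Q (y - x) ≤ V y) :
    ∀ x ∈ interior K, ∀ v : E, 2 * Q v ≤ iteratedFDeriv ℝ 2 V x ![v, v] :=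
  fun _ hx v => hessian_lower_of_firstOrderOn_form_inward Q hQ h (interior_subset hx) (hV.contDiffAt (isOpen_interior.mem_nhds hx))
    (nhdsWithin_le_nhds (eventually_lineSlice_mem v (mem_interior_iff_mem_nhds.1 hx)))

/-- **SECANT CURRENCY** (the output shape of `…LogConcaveMarginal` §6 ∕ `…ConvexityModulusSchur` §6): the secant letter with a
2-homogeneous `Q` on `K` and `V ∈ C²` ON `interior K` ⟹ `2·Q(v) ≤ D²V(x)[v, v]` at every interior point, every direction. [folklore] -/
theorem hessianOn_lower_of_secantForm {V : E → ℝ} {K : Set E} (hV : ContDiffOn ℝ 2 V (interior K)) (Q : E → ℝ)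
    (hQ : ∀ (t : ℝ) (v : E), Q (t • v) = t ^ 2 * Q v)
    (h : ∀ p ∈ K, ∀ q ∈ K, ∀ a b : ℝ, 0 ≤ a → 0 ≤ b → a + b = 1 → V (a • p + b • q) + a * b * Q (q - p) ≤ a * V p + b * V q) :
    ∀ x ∈ interior K, ∀ v : E, 2 * Q v ≤ iteratedFDeriv ℝ 2 V x ![v, v] := by
  intro x hx v
  rw [iteratedFDeriv_two_apply]
  have hVx : ContDiffAt ℝ 2 V x := hV.contDiffAt (isOpen_interior.mem_nhds hx)
  exact le_hessian_of_secantForm_nhds (K := interior K) (isOpen_interior.mem_nhds hx) (eventually_hasFDerivAt_of_contDiffAt hVx)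
    (hasFDerivAt_fderiv_of_contDiffAt hVx) Q hQ
    (fun p hp q hq a b ha hb hab => h p (interior_subset hp) q (interior_subset hq) a b ha hb hab) v

/-- **HESSIAN MONOTONICITY ON A WINDOW**: `ConvexOn ℝ K (V − W)` with `V, W ∈ C²` ON `interior K` ⟹ `D²W(x)[v, v] ≤ D²V(x)[v, v]` at
every interior point of `K`, every direction. [folklore] -/
theorem hessianOn_mono_of_convexOn_sub {V W : E → ℝ} {K : Set E} (hV : ContDiffOn ℝ 2 V (interior K))
    (hW : ContDiffOn ℝ 2 W (interior K)) (h : ConvexOn ℝ K (fun y => V y - W y)) :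
    ∀ x ∈ interior K, ∀ v : E, iteratedFDeriv ℝ 2 W x ![v, v] ≤ iteratedFDeriv ℝ 2 V x ![v, v] := by
  intro x hx v
  rw [iteratedFDeriv_two_apply, iteratedFDeriv_two_apply]
  have hVx : ContDiffAt ℝ 2 V x := hV.contDiffAt (isOpen_interior.mem_nhds hx)
  have hWx : ContDiffAt ℝ 2 W x := hW.contDiffAt (isOpen_interior.mem_nhds hx)
  exact hessian_mono_of_convexOn_sub_nhds (K := interior K) (isOpen_interior.mem_nhds hx) (eventually_hasFDerivAt_of_contDiffAt hVx)
    (hasFDerivAt_fderiv_of_contDiffAt hVx) (eventually_hasFDerivAt_of_contDiffAt hWx) (hasFDerivAt_fderiv_of_contDiffAt hWx)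
    (h.subset interior_subset h.1.interior) v

/-- **SCALAR MODULUS**: `StrongConvexOn K m V` with `V ∈ C²` ON `interior K` ⟹ `m‖v‖² ≤ D²V(x)[v, v]` at every interior point — the
hypothesis `hH` of `…ConvexWindowSuppliers.firstOrderOn_of_hessianOn_lower` with `κ := m`, on `interior K`. [folklore] -/
theorem hessianOn_lower_of_strongConvexOn {V : E → ℝ} {K : Set E} {m : ℝ} (hV : ContDiffOn ℝ 2 V (interior K))
    (h : StrongConvexOn K m V) : ∀ x ∈ interior K, ∀ v : E, m * ‖v‖ ^ 2 ≤ iteratedFDeriv ℝ 2 V x ![v, v] := by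
  intro x hx v
  rw [iteratedFDeriv_two_apply]
  have hVx : ContDiffAt ℝ 2 V x := hV.contDiffAt (isOpen_interior.mem_nhds hx)
  have h' : StrongConvexOn (interior K) m V :=
    ⟨h.1.interior, fun p hp q hq a b ha hb hab => h.2 (interior_subset hp) (interior_subset hq) ha hb hab⟩
  exact le_hessian_of_strongConvexOn_nhds (isOpen_interior.mem_nhds hx) (eventually_hasFDerivAt_of_contDiffAt hVx)
    (hasFDerivAt_fderiv_of_contDiffAt hVx) h' v

end Window

section WindowInner

variable {E : Type*} [NormedAddCommGroup E] [InnerProductSpace ℝ E]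

/-- **FIELD CURRENCY** (the letter shape `h` of `…ConvexityModulusTransport.secant_of_firstOrderOn_form` ∕
`…StrongConvexSubgradientField` §5, ANY vector field `dV`): the letter `V x + ⟪dV x, y − x⟫ + Q(y − x) ≤ V y` on `K` with a
2-homogeneous `Q` and `V ∈ C²` ON `interior K` ⟹ `2·Q(v) ≤ D²V(x)[v, v]` at interior points (`dV = ∇V` there is forced, not assumed).
[folklore] -/
theorem hessianOn_lower_of_firstOrderOn_formField {V : E → ℝ} {dV : E → E} {K : Set E} (hV : ContDiffOn ℝ 2 V (interior K))
    (Q : E → ℝ) (hQ : ∀ (t : ℝ) (v : E), Q (t • v) = t ^ 2 * Q v) (h : ∀ x ∈ K, ∀ y ∈ K, V x + ⟪dV x, y - x⟫ + Q (y - x) ≤ V y) :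
    ∀ x ∈ interior K, ∀ v : E, 2 * Q v ≤ iteratedFDeriv ℝ 2 V x ![v, v] := by
  intro x hx v
  rw [iteratedFDeriv_two_apply]
  have hVx : ContDiffAt ℝ 2 V x := hV.contDiffAt (isOpen_interior.mem_nhds hx)
  refine le_hessian_of_firstOrderForm_nhds (K := K) (mem_interior_iff_mem_nhds.1 hx) (eventually_hasFDerivAt_of_contDiffAt hVx)
    (hasFDerivAt_fderiv_of_contDiffAt hVx) Q hQ (innerSL ℝ (dV x)) (fun y hy => ?_) v
  rw [innerSL_apply_apply]
  exact h x (interior_subset hx) y hy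

variable [CompleteSpace E]

/-- **GRADIENT CURRENCY** (the letter shape of `…HessianFormFirstOrder` §2 ∕ `…ConvexWindowSuppliers`): the letter
`V x + ⟪∇V x, y − x⟫ + Q(y − x) ≤ V y` on `K` with a 2-homogeneous `Q` and `V ∈ C²` ON `interior K` ⟹ `2·Q(v) ≤ D²V(x)[v, v]` at
interior points. [folklore] -/
theorem hessianOn_lower_of_firstOrderOn_form {V : E → ℝ} {K : Set E} (hV : ContDiffOn ℝ 2 V (interior K)) (Q : E → ℝ)
    (hQ : ∀ (t : ℝ) (v : E), Q (t • v) = t ^ 2 * Q v) (h : ∀ x ∈ K, ∀ y ∈ K, V x + ⟪gradient V x, y - x⟫ + Q (y - x) ≤ V y) :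
    ∀ x ∈ interior K, ∀ v : E, 2 * Q v ≤ iteratedFDeriv ℝ 2 V x ![v, v] :=
  hessianOn_lower_of_firstOrderOn_form_fderiv hV Q hQ fun x hx y hy => by rw [← inner_gradient_left]; exact h x hx y hy

end WindowInner

/-! ## §5 Toy check (kernel): the letters are not vacuous and the converse is sharp -/

section Toy

variable {E : Type*} [NormedAddCommGroup E] [InnerProductSpace ℝ E]

/-- Toy: for `V = ‖·‖²` the first-order letter with `Q = ‖·‖²` holds on the whole space (it is an equality,
`‖y‖² = ‖x‖² + 2⟪x, y − x⟫ + ‖y − x‖²`), and the converse returns `2‖v‖² ≤ D²V(x)[v, v]` at every point — sharp, since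
`D²‖·‖²[v, v] = 2‖v‖²`. -/
example : ∀ x ∈ interior (univ : Set E), ∀ v : E, 2 * ‖v‖ ^ 2 ≤ iteratedFDeriv ℝ 2 (fun y : E => ‖y‖ ^ 2) x ![v, v] := by
  have hV : ContDiff ℝ 2 (fun y : E => ‖y‖ ^ 2) := contDiff_norm_sq ℝ
  refine hessianOn_lower_of_firstOrderOn_form_fderiv hV.contDiffOn (fun v : E => ‖v‖ ^ 2) (fun t v => ?_) (fun x _ y _ => ?_)
  · rw [norm_smul, mul_pow, Real.norm_eq_abs, sq_abs]
  · rw [(hasStrictFDerivAt_norm_sq x).hasFDerivAt.fderiv]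
    simp only [smul_apply, innerSL_apply_apply, nsmul_eq_mul, Nat.cast_ofNat]
    have : ‖y‖ ^ 2 = ‖x + (y - x)‖ ^ 2 := by rw [add_sub_cancel]
    rw [this, norm_add_sq_real]

end Toy

end Summit.QuantumFields.BalabanUV.T4Continuum.NE7b.HessianFloorOfFormLetter
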